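import Summits.QuantumFields.YangMills.Theorems.BalabanUVNodesN15KingModelOSReflectionPositivity
import Summits.QuantumFields.YangMills.Theorems.BalabanUVNodesN15KingModelReflectionPositivityCharFun
import Summits.QuantumFields.YangMills.Theorems.BalabanUVNodesN15KingModelInfiniteVolumeClustering

/-!
# BalabanUVNodes ∕ N15 — THE KING-MODEL RUNG (PART Ͳ-d₁): EXPONENTIAL CLUSTERING OF THE OSTERWALDER–SCHRADER PAIRING ON THE EXPONENTIAL ALGEBRA —
# `|∫ conj F(φ∘θ)·F(S^tφ) dμ_∞ − (∫ conj F(φ∘θ) dμ_∞)(∫ F dμ_∞)| ≤ C_{F,ε} e^{−(1−ε)√m² t}` for every trigonometric polynomial `F = Σ_k a_k e^{iφ(f_k)}` of the time-`≥ 0` field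
# (Track A, DAG node N15 = NE2; FAN-OUT v1.1 §N15 s3 «KING-MODEL RUNG»; count-neutral)

HONEST FRAMING.  Count-neutral (cell `pub-ymgap`, seat `pub-ymgap-dag-n15-e` g36; `--supports stmt-QuantumFields-27366 --as helper` = K3⁸).  King's `A = 0`, `g = 0` model
([King1986] C. King, Commun. Math. Phys. **102** (1986) 649–677): the FREE massive block field `μ_∞` of part Ϻ-n with the tree's lattice OS data (part Ͳ-c₁).  For the EXPONENTIAL
(trigonometric-polynomial) observables `F(φ) = Σ_k a_k exp(iΣ_{z∈s} f_k(z)φ(z))` (`a_k ∈ ℂ`, `f_k` real, `s` finite) — a bounded observable measurable in the coordinates in `s` — the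
Osterwalder–Schrader pairing against the time-shifted copy is EXPLICIT: ★★ `∫ conj F(φ∘θ)·F(S^tφ) dμ_∞ = Σ_{k,l} conj(a_k)a_l e^{−V_k∕2}e^{−V_l∕2}e^{M_t(k,l)}` with `V_k = ΣΣ f_kf_kS₂^{ℝ}`,
`M_t(k,l) = Σ_{z,w}f_k(z)f_l(w)S₂^{ℝ}(w + te₀ − θz)` (one combined Gaussian field sum per cross term, part Ϻ-r's method with two site maps), so the TRUNCATED pairing is
`Σ conj(a_k)a_l e^{−(V_k+V_l)∕2}(e^{M_t(k,l)} − 1)` and, by part Ϻ-q's shifted cross-form bound (`abs_crossForm_shift_le`, Euclidean rate `(1−ε)√m²` of part Ϻ-d) and `|e^x − 1| ≤ |x|e^{|x|}`,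
★★★ **`|∫ conj F(φ∘θ)·F(S^tφ) dμ_∞ − (∫ conj F(φ∘θ))(∫ F)| ≤ C_{F,ε}·e^{−(1−ε)√m²·t}`** for all `t ∈ ℕ`, every `0 < ε ≤ 1` (`os_truncated_trigPoly_norm_le`).  Under the OS realisation of part Ͳ-c₂
the left side is `⟪ιF, T^t ιF⟫ − ⟪ιF, Ω⟫⟪Ω, ιF⟫`: this is the clustering input of the tree's `gapNorm_le_exp_of_dense_clustering` on the exponential algebra (part Ͳ-d₂∕d₃ supply its density
and conclude the mass gap of the transfer operator).  NOT Bałaban's objects; NOT a node discharge; nothing continuum ∕ `ℝ⁴` ∕ Clay.  0 `sorry`, 0 def; standard axioms.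

WHAT THIS FILE PROVES (kernel).  §1 ★ `integral_conj_cexp_mul_cexp_siteMaps` (two site maps, closed form), `latticeTimeShift_iterate_apply'`; §2 `norm_trigPoly_le`, `measurable_trigPoly_cylinder`,
`isBoundedMeasurable_trigPoly`, `integral_trigPoly`, `integral_conj_trigPoly_reflect`; §3 ★★ `os_pairing_trigPoly_shift_eq`, ★★ `os_truncated_trigPoly_eq`, `abs_shiftGram_le`,
★★★ **`os_truncated_trigPoly_norm_le`**.

HONEST SCOPE.  King's free infinite-volume block field (`m² > 0`, every `d`).  N15 untouched; counts unmoved.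
Locators (use): [King1986] Thm 2.1 (2.22)–(2.23) p.654, (4.5) p.670, Thm 3.3 (3.6) p.656; Glimm–Jaffe 1987 §6.1 Thm. 6.1.3, §6.2 Thm. 6.2.2, §19.7.
-/

noncomputable section

open scoped BigOperators Topology ComplexConjugate
open Filter MeasureTheory ProbabilityTheory Finset Complex

namespace Summit.QuantumFields.YangMills.BalabanUVNodes.N15KingModelRung.InfiniteVolume

open Literature.MathematicalPhysics.QuantumFieldTheory (latticeTimeReflection latticeTimeReflection_apply positiveTimeSites positiveTimeEvents latticeTimeShift
  latticeTimeShift_apply)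
open Literature.Probability.LatticeModels (configReflect configReflect_apply positiveEvents IsBoundedMeasurable)
open Summit.QuantumFields.YangMills.BalabanUVNodes.N15KingModelRung.OptimalDecay
open Summit.QuantumFields.YangMills.BalabanUVNodes.N15KingModelRung.ProperTime

variable {d : ℕ}

/-! ## §1 The cross term for two site maps -/

/-- ★ **ONE COMBINED FIELD SUM PER CROSS TERM** (part Ϻ-r's method, two arbitrary site maps `α, β`): with `V_α(g) = Σ_{z,w}g(z)g(w)S₂^{ℝ}(αw − αz)`, `V_β(h)` likewise and
`M = Σ_{z,w}g(z)h(w)S₂^{ℝ}(βw − αz)`: `∫ conj(e^{iΣ g(z)φ(αz)})·e^{iΣ h(z)φ(βz)} dμ_∞ = e^{−V_α(g)∕2}e^{−V_β(h)∕2}e^{M}` (the characteristic functional of `φ(h∘β) − φ(g∘α)`).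
[cite: King1986, Thm 2.1 (2.22) p.654; GlimmJaffe1987, §6.2 Thm. 6.2.2] -/
theorem integral_conj_cexp_mul_cexp_siteMaps {m2 : ℝ} (hm : 0 < m2) (s : Finset (Fin (d + 1) → ℤ)) (g h : (Fin (d + 1) → ℤ) → ℝ)
    (α β : (Fin (d + 1) → ℤ) → (Fin (d + 1) → ℤ)) :
    ∫ ω, conj (Complex.exp (((∑ z ∈ s, g z * ω (α z) : ℝ) : ℂ) * I)) * Complex.exp (((∑ z ∈ s, h z * ω (β z) : ℝ) : ℂ) * I) ∂kingFieldInf m2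
      = ((Real.exp (-((∑ z ∈ s, ∑ w ∈ s, g z * g w * kingS2Inf m2 (α w - α z)) / 2)) : ℝ) : ℂ)
        * ((Real.exp (-((∑ z ∈ s, ∑ w ∈ s, h z * h w * kingS2Inf m2 (β w - β z)) / 2)) : ℝ) : ℂ)
        * ((Real.exp (∑ z ∈ s, ∑ w ∈ s, g z * h w * kingS2Inf m2 (β w - α z)) : ℝ) : ℂ) := by
  haveI := isProbabilityMeasure_kingFieldInf (d := d) hm
  set Vg : ℝ := ∑ z ∈ s, ∑ w ∈ s, g z * g w * kingS2Inf m2 (α w - α z) with hVg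
  set Vh : ℝ := ∑ z ∈ s, ∑ w ∈ s, h z * h w * kingS2Inf m2 (β w - β z) with hVh
  set M : ℝ := ∑ z ∈ s, ∑ w ∈ s, g z * h w * kingS2Inf m2 (β w - α z) with hM
  set p : Bool × (Fin (d + 1) → ℤ) → (Fin (d + 1) → ℤ) := fun q => if q.1 then α q.2 else β q.2 with hp
  set c : Bool × (Fin (d + 1) → ℤ) → ℝ := fun q => if q.1 then -g q.2 else h q.2 with hc
  have hsplit : ∀ ω : (Fin (d + 1) → ℤ) → ℝ, ∑ q ∈ Finset.univ ×ˢ s, c q * ω (p q) = -(∑ z ∈ s, g z * ω (α z)) + ∑ z ∈ s, h z * ω (β z) := by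
    intro ω
    rw [Finset.sum_product, Fintype.sum_bool]
    simp [hp, hc, Finset.sum_neg_distrib]
  have hfun : (fun ω : (Fin (d + 1) → ℤ) → ℝ => conj (Complex.exp (((∑ z ∈ s, g z * ω (α z) : ℝ) : ℂ) * I)) * Complex.exp (((∑ z ∈ s, h z * ω (β z) : ℝ) : ℂ) * I))
      = fun ω => Complex.exp (((∑ q ∈ Finset.univ ×ˢ s, c q * ω (p q) : ℝ) : ℂ) * I) := by
    funext ω
    rw [← Complex.exp_conj, map_mul, Complex.conj_ofReal, Complex.conj_I, ← Complex.exp_add, hsplit]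
    push_cast
    ring_nf
  have hvar : ∑ q ∈ Finset.univ ×ˢ s, ∑ q' ∈ Finset.univ ×ˢ s, c q * c q' * kingS2Inf m2 (p q' - p q) = Vg + Vh - 2 * M := by
    rw [Finset.sum_product, Fintype.sum_bool]
    simp only [Finset.sum_product, Fintype.sum_bool, hp, hc, if_true, Bool.false_eq_true, if_false, Finset.sum_add_distrib]
    have hAA : ∑ z ∈ s, ∑ w ∈ s, -g z * -g w * kingS2Inf m2 (α w - α z) = Vg := by
      refine Finset.sum_congr rfl fun z _ => Finset.sum_congr rfl fun w _ => ?_; ring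
    have hAB : ∑ z ∈ s, ∑ w ∈ s, -g z * h w * kingS2Inf m2 (β w - α z) = -M := by
      rw [hM]
      simp only [← Finset.sum_neg_distrib]
      refine Finset.sum_congr rfl fun z _ => Finset.sum_congr rfl fun w _ => ?_; ring
    have hBA : ∑ z ∈ s, ∑ w ∈ s, h z * -g w * kingS2Inf m2 (α w - β z) = -M := by
      rw [hM]
      simp only [← Finset.sum_neg_distrib]
      rw [Finset.sum_comm]
      refine Finset.sum_congr rfl fun z _ => Finset.sum_congr rfl fun w _ => ?_
      rw [← kingS2Inf_neg m2 (α z - β w), neg_sub]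
      ring
    rw [hAA, hAB, hBA]
    ring
  rw [hfun, integral_cexp_I_fieldSum hm, hvar, ← Complex.ofReal_mul, ← Complex.ofReal_mul, ← Real.exp_add, ← Real.exp_add, Complex.ofReal_exp]
  congr 1
  push_cast
  ring

/-- Iterates of the unit time shift: `(S^[t]φ)(x) = φ(x + te₀)`. [folklore] -/
theorem latticeTimeShift_iterate_apply' (t : ℕ) (ω : (Fin (d + 1) → ℤ) → ℝ) (x : Fin (d + 1) → ℤ) :
    (latticeTimeShift (d + 1) ℝ)^[t] ω x = ω (x + Pi.single 0 (t : ℤ)) := by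
  induction t generalizing x with
  | zero => simp
  | succ t ih =>
    rw [Function.iterate_succ_apply', latticeTimeShift_apply, ih]
    congr 1
    rw [add_assoc, ← Pi.single_add]
    push_cast
    ring_nf

/-! ## §2 The exponential (trigonometric-polynomial) observables -/

variable {ι : Type*} [Fintype ι]

/-- `|Σ_k a_k e^{iφ(f_k)}| ≤ Σ_k |a_k|`. [folklore] -/
theorem norm_trigPoly_le (a : ι → ℂ) (s : Finset (Fin (d + 1) → ℤ)) (f : ι → (Fin (d + 1) → ℤ) → ℝ) (p : (Fin (d + 1) → ℤ) → (Fin (d + 1) → ℤ))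
    (ω : (Fin (d + 1) → ℤ) → ℝ) :
    ‖∑ k, a k * Complex.exp (((∑ z ∈ s, f k z * ω (p z) : ℝ) : ℂ) * I)‖ ≤ ∑ k, ‖a k‖ := by
  refine (norm_sum_le _ _).trans (Finset.sum_le_sum fun k _ => ?_)
  rw [norm_mul, Complex.norm_exp_ofReal_mul_I, mul_one]

/-- `Σ_k a_k e^{iΣ_{z∈s} f_k(z)φ(p z)}` is measurable in the coordinates `p(s)`. [folklore] -/
theorem measurable_trigPoly_cylinder (a : ι → ℂ) (s : Finset (Fin (d + 1) → ℤ)) (f : ι → (Fin (d + 1) → ℤ) → ℝ)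
    {P : Set (Fin (d + 1) → ℤ)} {p : (Fin (d + 1) → ℤ) → (Fin (d + 1) → ℤ)} (hp : ∀ z ∈ s, p z ∈ P) :
    Measurable[positiveEvents (S := ℝ) P] fun ω : (Fin (d + 1) → ℤ) → ℝ => ∑ k, a k * Complex.exp (((∑ z ∈ s, f k z * ω (p z) : ℝ) : ℂ) * I) := by
  refine Finset.measurable_sum _ fun k _ => ?_
  refine Measurable.const_mul ?_ _
  refine Complex.measurable_exp.comp (Measurable.mul_const (Complex.measurable_ofReal.comp ?_) I)
  refine Finset.measurable_sum _ fun z hz => Measurable.const_mul ?_ _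
  exact measurable_cylinderEvent_apply (X := fun _ : Fin (d + 1) → ℤ => ℝ) (hp z hz)

/-- A trigonometric polynomial of positive-time fields is a bounded positive-time observable (`∈ 𝓔₊^∞`). [cite: GlimmJaffe1987, §6.1 (𝓔₊)] -/
theorem isBoundedMeasurable_trigPoly (a : ι → ℂ) {s : Finset (Fin (d + 1) → ℤ)} (hs : ∀ z ∈ s, z ∈ positiveTimeSites (d + 1)) (f : ι → (Fin (d + 1) → ℤ) → ℝ) :
    IsBoundedMeasurable (positiveTimeEvents (d + 1) ℝ) fun ω : (Fin (d + 1) → ℤ) → ℝ => ∑ k, a k * Complex.exp (((∑ z ∈ s, f k z * ω z : ℝ) : ℂ) * I) :=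
  ⟨measurable_trigPoly_cylinder a s f (p := id) hs, ∑ k, ‖a k‖, fun ω => norm_trigPoly_le a s f id ω⟩

/-- `∫ Σ_k a_k e^{iφ(f_k∘p)} dμ_∞ = Σ_k a_k e^{−V_k∕2}`, `V_k = ΣΣf_kf_kS₂^{ℝ}(pw − pz)`. [cite: King1986, Thm 2.1 (2.22) p.654] -/
theorem integral_trigPoly {m2 : ℝ} (hm : 0 < m2) (a : ι → ℂ) (s : Finset (Fin (d + 1) → ℤ)) (f : ι → (Fin (d + 1) → ℤ) → ℝ)
    (p : (Fin (d + 1) → ℤ) → (Fin (d + 1) → ℤ)) :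
    ∫ ω, ∑ k, a k * Complex.exp (((∑ z ∈ s, f k z * ω (p z) : ℝ) : ℂ) * I) ∂kingFieldInf m2
      = ∑ k, a k * ((Real.exp (-((∑ z ∈ s, ∑ w ∈ s, f k z * f k w * kingS2Inf m2 (p w - p z)) / 2)) : ℝ) : ℂ) := by
  rw [integral_finsetSum _ fun k _ => (integrable_cexp_I_fieldSum hm s (fun z => p z) (f k)).const_mul (a k)]
  refine Finset.sum_congr rfl fun k _ => ?_
  rw [integral_const_mul, integral_cexp_I_fieldSum hm s (fun z => p z) (f k), Complex.ofReal_exp]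
  push_cast
  ring_nf

/-- `∫ conj(Σ_k a_k e^{iφ(f_k∘p)}) dμ_∞ = Σ_k conj(a_k) e^{−V_k∕2}`. [cite: King1986, Thm 2.1 (2.22) p.654] -/
theorem integral_conj_trigPoly {m2 : ℝ} (hm : 0 < m2) (a : ι → ℂ) (s : Finset (Fin (d + 1) → ℤ)) (f : ι → (Fin (d + 1) → ℤ) → ℝ)
    (p : (Fin (d + 1) → ℤ) → (Fin (d + 1) → ℤ)) :
    ∫ ω, conj (∑ k, a k * Complex.exp (((∑ z ∈ s, f k z * ω (p z) : ℝ) : ℂ) * I)) ∂kingFieldInf m2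
      = ∑ k, conj (a k) * ((Real.exp (-((∑ z ∈ s, ∑ w ∈ s, f k z * f k w * kingS2Inf m2 (p w - p z)) / 2)) : ℝ) : ℂ) := by
  rw [integral_conj, integral_trigPoly hm a s f p, map_sum]
  refine Finset.sum_congr rfl fun k _ => ?_
  rw [map_mul, Complex.conj_ofReal]

/-! ## §3 The Osterwalder–Schrader pairing against the shifted copy, and its exponential clustering -/

/-- ★★ **THE OS PAIRING OF `F` WITH ITS TIME-`t` TRANSLATE, IN CLOSED FORM**: for `F = Σ_k a_k e^{iΣ_{z∈s}f_k(z)φ(z)}`,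
`∫ conj F(φ∘θ)·F(S^tφ) dμ_∞ = Σ_{k,l} conj(a_k)a_l e^{−V_k∕2}e^{−V_l∕2}e^{M_t(k,l)}`, `V_k = Σ_{z,w}f_k(z)f_k(w)S₂^{ℝ}(w−z)`, `M_t(k,l) = Σ_{z,w}f_k(z)f_l(w)S₂^{ℝ}(w + te₀ − θz)`.
[cite: King1986, Thm 2.1 (2.22) p.654; GlimmJaffe1987, §6.1 (6.1.12), §6.2 Thm. 6.2.2] -/
theorem os_pairing_trigPoly_shift_eq {m2 : ℝ} (hm : 0 < m2) (a : ι → ℂ) (s : Finset (Fin (d + 1) → ℤ)) (f : ι → (Fin (d + 1) → ℤ) → ℝ) (t : ℕ) :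
    ∫ ω, conj ((fun ω : (Fin (d + 1) → ℤ) → ℝ => ∑ k, a k * Complex.exp (((∑ z ∈ s, f k z * ω z : ℝ) : ℂ) * I)) (configReflect (latticeTimeReflection (d + 1)) ω))
        * (fun ω : (Fin (d + 1) → ℤ) → ℝ => ∑ k, a k * Complex.exp (((∑ z ∈ s, f k z * ω z : ℝ) : ℂ) * I)) ((latticeTimeShift (d + 1) ℝ)^[t] ω) ∂kingFieldInf m2
      = ∑ k, ∑ l, conj (a k) * a l
          * (((Real.exp (-((∑ z ∈ s, ∑ w ∈ s, f k z * f k w * kingS2Inf m2 (w - z)) / 2)) : ℝ) : ℂ)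
            * ((Real.exp (-((∑ z ∈ s, ∑ w ∈ s, f l z * f l w * kingS2Inf m2 (w - z)) / 2)) : ℝ) : ℂ)
            * ((Real.exp (∑ z ∈ s, ∑ w ∈ s, f k z * f l w * kingS2Inf m2 (w + Pi.single 0 (t : ℤ) - latticeTimeReflection (d + 1) z)) : ℝ) : ℂ)) := by
  haveI := isProbabilityMeasure_kingFieldInf (d := d) hm
  set θ : (Fin (d + 1) → ℤ) → (Fin (d + 1) → ℤ) := fun z => latticeTimeReflection (d + 1) z with hθ
  set τ : (Fin (d + 1) → ℤ) → (Fin (d + 1) → ℤ) := fun z => z + Pi.single 0 (t : ℤ) with hτ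
  -- rewrite the two observables through the site maps
  have hrefl : ∀ ω : (Fin (d + 1) → ℤ) → ℝ, (fun ω : (Fin (d + 1) → ℤ) → ℝ => ∑ k, a k * Complex.exp (((∑ z ∈ s, f k z * ω z : ℝ) : ℂ) * I)) (configReflect (latticeTimeReflection (d + 1)) ω)
      = ∑ k, a k * Complex.exp (((∑ z ∈ s, f k z * ω (θ z) : ℝ) : ℂ) * I) := fun ω => by
    simp only [configReflect_apply, hθ]
  have hshift : ∀ ω : (Fin (d + 1) → ℤ) → ℝ, (fun ω : (Fin (d + 1) → ℤ) → ℝ => ∑ k, a k * Complex.exp (((∑ z ∈ s, f k z * ω z : ℝ) : ℂ) * I)) ((latticeTimeShift (d + 1) ℝ)^[t] ω)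
      = ∑ k, a k * Complex.exp (((∑ z ∈ s, f k z * ω (τ z) : ℝ) : ℂ) * I) := fun ω => by
    simp only [latticeTimeShift_iterate_apply', hτ]
  simp_rw [hrefl, hshift]
  -- expand the product of sums and integrate termwise
  have hint : ∀ k l, Integrable (fun ω : (Fin (d + 1) → ℤ) → ℝ =>
      conj (a k * Complex.exp (((∑ z ∈ s, f k z * ω (θ z) : ℝ) : ℂ) * I)) * (a l * Complex.exp (((∑ z ∈ s, f l z * ω (τ z) : ℝ) : ℂ) * I))) (kingFieldInf m2) := by
    intro k l
    refine (integrable_const (‖a k‖ * ‖a l‖)).mono' (by fun_prop) (Eventually.of_forall fun ω => ?_)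
    simp only [norm_mul, Complex.norm_conj, Complex.norm_exp_ofReal_mul_I, mul_one, le_refl]
  have hexp : (fun ω : (Fin (d + 1) → ℤ) → ℝ => conj (∑ k, a k * Complex.exp (((∑ z ∈ s, f k z * ω (θ z) : ℝ) : ℂ) * I))
        * (∑ l, a l * Complex.exp (((∑ z ∈ s, f l z * ω (τ z) : ℝ) : ℂ) * I)))
      = fun ω => ∑ k, ∑ l, conj (a k * Complex.exp (((∑ z ∈ s, f k z * ω (θ z) : ℝ) : ℂ) * I)) * (a l * Complex.exp (((∑ z ∈ s, f l z * ω (τ z) : ℝ) : ℂ) * I)) := by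
    funext ω
    rw [map_sum, Finset.sum_mul_sum]
  rw [hexp, integral_finsetSum _ fun k _ => integrable_finsetSum _ fun l _ => hint k l]
  simp_rw [integral_finsetSum _ fun l _ => hint _ l]
  refine Finset.sum_congr rfl fun k _ => Finset.sum_congr rfl fun l _ => ?_
  have e : (fun ω : (Fin (d + 1) → ℤ) → ℝ => conj (a k * Complex.exp (((∑ z ∈ s, f k z * ω (θ z) : ℝ) : ℂ) * I)) * (a l * Complex.exp (((∑ z ∈ s, f l z * ω (τ z) : ℝ) : ℂ) * I)))
      = fun ω => (conj (a k) * a l) * (conj (Complex.exp (((∑ z ∈ s, f k z * ω (θ z) : ℝ) : ℂ) * I)) * Complex.exp (((∑ z ∈ s, f l z * ω (τ z) : ℝ) : ℂ) * I)) := by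
    funext ω; rw [map_mul]; ring
  rw [e, integral_const_mul, integral_conj_cexp_mul_cexp_siteMaps hm s (f k) (f l) θ τ]
  -- the two variances are the unshifted ones (reflection ∕ translation invariance of `S₂^{ℝ}`)
  have hVθ : ∑ z ∈ s, ∑ w ∈ s, f k z * f k w * kingS2Inf m2 (θ w - θ z) = ∑ z ∈ s, ∑ w ∈ s, f k z * f k w * kingS2Inf m2 (w - z) := by
    refine Finset.sum_congr rfl fun z _ => Finset.sum_congr rfl fun w _ => ?_
    rw [hθ]
    simp only [latticeTimeReflection_eq_update]
    rw [kingS2Inf_reflect_sub_reflect]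
  have hVτ : ∑ z ∈ s, ∑ w ∈ s, f l z * f l w * kingS2Inf m2 (τ w - τ z) = ∑ z ∈ s, ∑ w ∈ s, f l z * f l w * kingS2Inf m2 (w - z) := by
    refine Finset.sum_congr rfl fun z _ => Finset.sum_congr rfl fun w _ => ?_
    rw [hτ, add_sub_add_right_eq_sub]
  rw [hVθ, hVτ]

/-- ★★ **THE TRUNCATED OS PAIRING IN CLOSED FORM**: `∫ conj F(φ∘θ)·F(S^tφ) − (∫ conj F(φ∘θ))(∫ F) = Σ_{k,l} conj(a_k)a_l e^{−(V_k+V_l)∕2}(e^{M_t(k,l)} − 1)`.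
[cite: King1986, Thm 2.1 (2.22) p.654; GlimmJaffe1987, §19.7] -/
theorem os_truncated_trigPoly_eq {m2 : ℝ} (hm : 0 < m2) (a : ι → ℂ) (s : Finset (Fin (d + 1) → ℤ)) (f : ι → (Fin (d + 1) → ℤ) → ℝ) (t : ℕ) :
    (∫ ω, conj ((fun ω : (Fin (d + 1) → ℤ) → ℝ => ∑ k, a k * Complex.exp (((∑ z ∈ s, f k z * ω z : ℝ) : ℂ) * I)) (configReflect (latticeTimeReflection (d + 1)) ω))
        * (fun ω : (Fin (d + 1) → ℤ) → ℝ => ∑ k, a k * Complex.exp (((∑ z ∈ s, f k z * ω z : ℝ) : ℂ) * I)) ((latticeTimeShift (d + 1) ℝ)^[t] ω) ∂kingFieldInf m2)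
      - (∫ ω, conj ((fun ω : (Fin (d + 1) → ℤ) → ℝ => ∑ k, a k * Complex.exp (((∑ z ∈ s, f k z * ω z : ℝ) : ℂ) * I)) (configReflect (latticeTimeReflection (d + 1)) ω)) ∂kingFieldInf m2)
        * (∫ ω, (fun ω : (Fin (d + 1) → ℤ) → ℝ => ∑ k, a k * Complex.exp (((∑ z ∈ s, f k z * ω z : ℝ) : ℂ) * I)) ω ∂kingFieldInf m2)
      = ∑ k, ∑ l, conj (a k) * a l
          * (((Real.exp (-((∑ z ∈ s, ∑ w ∈ s, f k z * f k w * kingS2Inf m2 (w - z)) / 2)) : ℝ) : ℂ)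
            * ((Real.exp (-((∑ z ∈ s, ∑ w ∈ s, f l z * f l w * kingS2Inf m2 (w - z)) / 2)) : ℝ) : ℂ)
            * (((Real.exp (∑ z ∈ s, ∑ w ∈ s, f k z * f l w * kingS2Inf m2 (w + Pi.single 0 (t : ℤ) - latticeTimeReflection (d + 1) z)) : ℝ) : ℂ) - 1)) := by
  rw [os_pairing_trigPoly_shift_eq hm a s f t]
  have hrefl : (fun ω : (Fin (d + 1) → ℤ) → ℝ => conj ((fun ω : (Fin (d + 1) → ℤ) → ℝ => ∑ k, a k * Complex.exp (((∑ z ∈ s, f k z * ω z : ℝ) : ℂ) * I)) (configReflect (latticeTimeReflection (d + 1)) ω)))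
      = fun ω => conj (∑ k, a k * Complex.exp (((∑ z ∈ s, f k z * ω (latticeTimeReflection (d + 1) z) : ℝ) : ℂ) * I)) := by
    funext ω
    simp only [configReflect_apply]
  rw [hrefl, integral_conj_trigPoly hm a s f (fun z => latticeTimeReflection (d + 1) z)]
  have hid : ∫ ω, (fun ω : (Fin (d + 1) → ℤ) → ℝ => ∑ k, a k * Complex.exp (((∑ z ∈ s, f k z * ω z : ℝ) : ℂ) * I)) ω ∂kingFieldInf m2
      = ∑ k, a k * ((Real.exp (-((∑ z ∈ s, ∑ w ∈ s, f k z * f k w * kingS2Inf m2 (w - z)) / 2)) : ℝ) : ℂ) := by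
    have h := integral_trigPoly hm a s f id
    simpa only [id] using h
  rw [hid]
  have hVθ : ∀ k, ∑ z ∈ s, ∑ w ∈ s, f k z * f k w * kingS2Inf m2 (latticeTimeReflection (d + 1) w - latticeTimeReflection (d + 1) z)
      = ∑ z ∈ s, ∑ w ∈ s, f k z * f k w * kingS2Inf m2 (w - z) := fun k => by
    refine Finset.sum_congr rfl fun z _ => Finset.sum_congr rfl fun w _ => ?_
    simp only [latticeTimeReflection_eq_update]
    rw [kingS2Inf_reflect_sub_reflect]
  simp_rw [hVθ]
  rw [Finset.sum_mul_sum, ← Finset.sum_sub_distrib]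
  refine Finset.sum_congr rfl fun k _ => ?_
  rw [← Finset.sum_sub_distrib]
  refine Finset.sum_congr rfl fun l _ => ?_
  ring

/-- The shifted reflected Gram entry is exponentially small in `t`: `|M_t(k,l)| ≤ A_{kl}(ε)·e^{−(1−ε)√m²·t}` (part Ϻ-q's shifted cross-form bound, the shift `te₀` has norm `t`).
[cite: King1986, Thm 3.3 (3.6) p.656, Thm 2.1 (2.22) p.654] -/
theorem abs_shiftGram_le {m2 ε : ℝ} (hm : 0 < m2) (hε0 : 0 < ε) (hε1 : ε ≤ 1) (s : Finset (Fin (d + 1) → ℤ)) (g h : (Fin (d + 1) → ℤ) → ℝ) (t : ℕ) :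
    |∑ z ∈ s, ∑ w ∈ s, g z * h w * kingS2Inf m2 (w + Pi.single 0 (t : ℤ) - latticeTimeReflection (d + 1) z)|
      ≤ (∑ z ∈ s, ∑ w ∈ s, |g z| * |h w| * (Real.exp ((1 - ε) * Real.sqrt m2 * (1 + Real.sqrt (d + 1))) * (freePropRadial d (ε * m2) (Real.sqrt ε) + m2⁻¹))
            * Real.exp ((1 - ε) * Real.sqrt m2 * ‖WithLp.toLp 2 (fun μ => (((latticeTimeReflection (d + 1) z - w) μ : ℤ) : ℝ))‖))
          * Real.exp (-((1 - ε) * Real.sqrt m2 * t)) := by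
  have h := abs_crossForm_shift_le (d := d) hm hε0 hε1 s (fun z => latticeTimeReflection (d + 1) z) g s (fun w => w) h (Pi.single 0 (t : ℤ))
  have hnorm : ‖WithLp.toLp 2 (fun μ => (((Pi.single 0 (t : ℤ) : Fin (d + 1) → ℤ) μ : ℤ) : ℝ))‖ = t := by
    rw [euclidNorm_eq]
    have hsum : ∑ μ : Fin (d + 1), (((Pi.single 0 (t : ℤ) : Fin (d + 1) → ℤ) μ : ℤ) : ℝ) ^ 2 = (t : ℝ) ^ 2 := by
      rw [Finset.sum_eq_single (0 : Fin (d + 1))]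
      · simp
      · intro μ _ hμ; simp [Pi.single_eq_of_ne hμ]
      · intro h0; exact absurd (Finset.mem_univ _) h0
    rw [hsum, Real.sqrt_sq (Nat.cast_nonneg t)]
  rw [hnorm] at h
  exact h

/-- ★★★ **EXPONENTIAL CLUSTERING OF THE OS PAIRING ON THE EXPONENTIAL ALGEBRA**: for every trigonometric polynomial `F = Σ_k a_k e^{iΣ_{z∈s}f_k(z)φ(z)}` and every `0 < ε ≤ 1`
there is `C` with `‖∫ conj F(φ∘θ)·F(S^tφ) dμ_∞ − (∫ conj F(φ∘θ) dμ_∞)(∫ F dμ_∞)‖ ≤ C·e^{−(1−ε)√m²·t}` for all `t ∈ ℕ`.  Under part Ͳ-c₂'s OS realisation this is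
`|⟪ιF, T^t ιF⟫ − ⟪ιF,Ω⟫⟪Ω,ιF⟫| ≤ C e^{−(1−ε)√m² t}` — the clustering input of the tree's `gapNorm_le_exp_of_dense_clustering`. [cite: King1986, Thm 3.3 (3.6) p.656; GlimmJaffe1987, §19.7 Thm. 19.7.1] -/
theorem os_truncated_trigPoly_norm_le {m2 ε : ℝ} (hm : 0 < m2) (hε0 : 0 < ε) (hε1 : ε ≤ 1) (a : ι → ℂ) (s : Finset (Fin (d + 1) → ℤ))
    (f : ι → (Fin (d + 1) → ℤ) → ℝ) :
    ∃ C : ℝ, ∀ t : ℕ,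
      ‖(∫ ω, conj ((fun ω : (Fin (d + 1) → ℤ) → ℝ => ∑ k, a k * Complex.exp (((∑ z ∈ s, f k z * ω z : ℝ) : ℂ) * I)) (configReflect (latticeTimeReflection (d + 1)) ω))
          * (fun ω : (Fin (d + 1) → ℤ) → ℝ => ∑ k, a k * Complex.exp (((∑ z ∈ s, f k z * ω z : ℝ) : ℂ) * I)) ((latticeTimeShift (d + 1) ℝ)^[t] ω) ∂kingFieldInf m2)
        - (∫ ω, conj ((fun ω : (Fin (d + 1) → ℤ) → ℝ => ∑ k, a k * Complex.exp (((∑ z ∈ s, f k z * ω z : ℝ) : ℂ) * I)) (configReflect (latticeTimeReflection (d + 1)) ω)) ∂kingFieldInf m2)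
          * (∫ ω, (fun ω : (Fin (d + 1) → ℤ) → ℝ => ∑ k, a k * Complex.exp (((∑ z ∈ s, f k z * ω z : ℝ) : ℂ) * I)) ω ∂kingFieldInf m2)‖
        ≤ C * Real.exp (-((1 - ε) * Real.sqrt m2) * t) := by
  -- the uniform constants
  set A : ι → ι → ℝ := fun k l => ∑ z ∈ s, ∑ w ∈ s, |f k z| * |f l w| * (Real.exp ((1 - ε) * Real.sqrt m2 * (1 + Real.sqrt (d + 1))) * (freePropRadial d (ε * m2) (Real.sqrt ε) + m2⁻¹))
      * Real.exp ((1 - ε) * Real.sqrt m2 * ‖WithLp.toLp 2 (fun μ => (((latticeTimeReflection (d + 1) z - w) μ : ℤ) : ℝ))‖) with hA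
  have hA0 : ∀ k l, 0 ≤ A k l := fun k l => Finset.sum_nonneg fun z _ => Finset.sum_nonneg fun w _ => by
    have : 0 < freePropRadial d (ε * m2) (Real.sqrt ε) + m2⁻¹ := by
      have h1 := freePropRadial_pos (d := d) (mul_pos hε0 hm) (Real.sqrt_pos.mpr hε0)
      positivity
    positivity
  refine ⟨∑ k, ∑ l, ‖a k‖ * ‖a l‖ * (A k l * Real.exp (A k l)), fun t => ?_⟩
  rw [os_truncated_trigPoly_eq hm a s f t]
  have hdecay : 0 < Real.exp (-((1 - ε) * Real.sqrt m2) * t) := Real.exp_pos _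
  have hdecay1 : Real.exp (-((1 - ε) * Real.sqrt m2) * t) ≤ 1 := by
    rw [Real.exp_le_one_iff]
    have : 0 ≤ (1 - ε) * Real.sqrt m2 * t := by
      have := Real.sqrt_nonneg m2
      have : (0 : ℝ) ≤ t := Nat.cast_nonneg t
      have : 0 ≤ 1 - ε := by linarith
      positivity
    linarith
  calc _ ≤ ∑ k, ‖∑ l, conj (a k) * a l
          * (((Real.exp (-((∑ z ∈ s, ∑ w ∈ s, f k z * f k w * kingS2Inf m2 (w - z)) / 2)) : ℝ) : ℂ)
            * ((Real.exp (-((∑ z ∈ s, ∑ w ∈ s, f l z * f l w * kingS2Inf m2 (w - z)) / 2)) : ℝ) : ℂ)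
            * (((Real.exp (∑ z ∈ s, ∑ w ∈ s, f k z * f l w * kingS2Inf m2 (w + Pi.single 0 (t : ℤ) - latticeTimeReflection (d + 1) z)) : ℝ) : ℂ) - 1))‖ := norm_sum_le _ _
    _ ≤ ∑ k, ∑ l, ‖a k‖ * ‖a l‖ * (A k l * Real.exp (A k l)) * Real.exp (-((1 - ε) * Real.sqrt m2) * t) := by
        refine Finset.sum_le_sum fun k _ => (norm_sum_le _ _).trans (Finset.sum_le_sum fun l _ => ?_)
        set M : ℝ := ∑ z ∈ s, ∑ w ∈ s, f k z * f l w * kingS2Inf m2 (w + Pi.single 0 (t : ℤ) - latticeTimeReflection (d + 1) z) with hM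
        have hMle : |M| ≤ A k l * Real.exp (-((1 - ε) * Real.sqrt m2) * t) := by
          have h := abs_shiftGram_le (d := d) hm hε0 hε1 s (f k) (f l) t
          have e : Real.exp (-((1 - ε) * Real.sqrt m2 * t)) = Real.exp (-((1 - ε) * Real.sqrt m2) * t) := by ring_nf
          rw [e] at h
          exact h
        have hMle' : |M| ≤ A k l := hMle.trans ((mul_le_mul_of_nonneg_left hdecay1 (hA0 k l)).trans_eq (mul_one _))
        have hexp1 := Literature.NumberTheory.Sieve.BombieriSieve.abs_exp_sub_one_le M
        have hV1 : ∀ j, ‖((Real.exp (-((∑ z ∈ s, ∑ w ∈ s, f j z * f j w * kingS2Inf m2 (w - z)) / 2)) : ℝ) : ℂ)‖ ≤ 1 := fun j => by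
          rw [Complex.norm_real, Real.norm_eq_abs, abs_of_pos (Real.exp_pos _), Real.exp_le_one_iff]
          have hq : 0 ≤ ∑ z ∈ s, ∑ w ∈ s, f j z * f j w * kingS2Inf m2 (w - z) :=
            (kingS2Inf_posSemidef hm s (f j)).trans_eq (Finset.sum_congr rfl fun z _ => Finset.sum_congr rfl fun w _ => by ring)
          linarith
        rw [norm_mul, norm_mul, norm_mul, norm_mul, Complex.norm_conj]
        have hlast : ‖((Real.exp M : ℝ) : ℂ) - 1‖ ≤ A k l * Real.exp (A k l) * Real.exp (-((1 - ε) * Real.sqrt m2) * t) := by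
          rw [← Complex.ofReal_one, ← Complex.ofReal_sub, Complex.norm_real, Real.norm_eq_abs]
          calc |Real.exp M - 1| ≤ |M| * Real.exp |M| := hexp1
            _ ≤ (A k l * Real.exp (-((1 - ε) * Real.sqrt m2) * t)) * Real.exp (A k l) :=
                mul_le_mul hMle (Real.exp_le_exp.mpr hMle') (Real.exp_pos _).le (mul_nonneg (hA0 k l) hdecay.le)
            _ = A k l * Real.exp (A k l) * Real.exp (-((1 - ε) * Real.sqrt m2) * t) := by ring
        calc ‖a k‖ * ‖a l‖ * (‖((Real.exp (-((∑ z ∈ s, ∑ w ∈ s, f k z * f k w * kingS2Inf m2 (w - z)) / 2)) : ℝ) : ℂ)‖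
              * ‖((Real.exp (-((∑ z ∈ s, ∑ w ∈ s, f l z * f l w * kingS2Inf m2 (w - z)) / 2)) : ℝ) : ℂ)‖ * ‖((Real.exp M : ℝ) : ℂ) - 1‖)
            ≤ ‖a k‖ * ‖a l‖ * (1 * 1 * (A k l * Real.exp (A k l) * Real.exp (-((1 - ε) * Real.sqrt m2) * t))) := by
              refine mul_le_mul_of_nonneg_left ?_ (mul_nonneg (norm_nonneg _) (norm_nonneg _))
              exact mul_le_mul (mul_le_mul (hV1 k) (hV1 l) (norm_nonneg _) zero_le_one) hlast (norm_nonneg _) (by positivity)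
          _ = ‖a k‖ * ‖a l‖ * (A k l * Real.exp (A k l)) * Real.exp (-((1 - ε) * Real.sqrt m2) * t) := by ring
    _ = (∑ k, ∑ l, ‖a k‖ * ‖a l‖ * (A k l * Real.exp (A k l))) * Real.exp (-((1 - ε) * Real.sqrt m2) * t) := by
        rw [Finset.sum_mul]
        refine Finset.sum_congr rfl fun k _ => ?_
        rw [Finset.sum_mul]

end Summit.QuantumFields.YangMills.BalabanUVNodes.N15KingModelRung.InfiniteVolume
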